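import Summits.AtomisticToContinuum.HydrodynamicLimit.Theorems.JParityClosureLocalSecondLawContactKernel

/-!
# The pointwise form of relative odd chaos with a sign-free slack collapses to the integrated budget
(crux `LocalSecondLaw`, stmt-AtomisticToContinuum-13081; line `contact-asymmetry-information`, stub K1 `stub_relativeOddChaos`)

Lead finding (prover-line-stmt-AtomisticToContinuum-13081-a5-0), abstract-kernel level (part B vocabulary,
`Theorems/JParityClosureLocalSecondLawContactKernel.lean`).  The registered stub K1 asks, for every admissible pair, for an
integrable slack `e` with `∫ e ≤ η` such that a.e. `−κ·J/2 − e ≤ (qJ − q)·ψ_odd` (`J` the Jeffreys integrand, `ψ_odd` the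
`J`-odd part of the log pair-correlation).  Because `e` is existential and SIGN-FREE, the OPTIMAL SLACK
`e⋆ := −κ·J/2 − (qJ − q)·ψ_odd` satisfies the inequality with equality, is integrable under the four kernel integrabilities,
and has `∫ e⋆ = (1 − κ)·KL(QJ‖Q) − bookedProduction` (`∫ J = 2·KL`, `∫ (qJ − q)ψ_odd = oddLogCorrelation`,
`bookedProduction = KL + oddLogCorrelation`).  Hence (`exists_pointwise_iff_budget`, registered anchor
`contactKernel_collapse`): "∃ integrable `e`, `∫ e ≤ η`, pointwise K1 at level `κ`" ⟺ `(1 − κ)·KL(QJ‖Q) ≤ bookedProduction + η`.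
So the typed K1 carries exactly the integrated content `X ≥ −κA − η` the composition uses (the triage's "pointwise,
parity-resolved" sharpening is not implemented by a sign-free slack; requiring `0 ≤ e` would make it pointwise:
`∫ ((1 − κ)J/2 + (qJ − q)(log b − log bJ)/2)⁺ ≤ η`).

References: S. Kullback, *Information Theory and Statistics* (1959), Ch. 2 (KL / Jeffreys divergences); the identity
`P = A + X` is the line's kernel (crux-plan seat), cf. H. Spohn, *Large Scale Dynamics of Interacting Particles* (1991), I §3.
-/

noncomputable section

open scoped BigOperators Topology Classical MeasureTheory ENNReal
open Filter Set MeasureTheory Function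

namespace Summit.AtomisticToContinuum.HydrodynamicLimit.Theorems.LocalSecondLawContact

section KernelCollapse

variable {X : Type*} [MeasurableSpace X] {μ : Measure X} {J : X → X} {q b : X → ℝ}

/-- The OPTIMAL SLACK of pointwise relative odd chaos at level `κ`: `e⋆ = −κ·J/2 − (qJ − q)·ψ_odd` (equality in K1). -/
def optSlack (J : X → X) (q b : X → ℝ) (κ : ℝ) (x : X) : ℝ :=
  -(κ * (jeffreysIntegrand J q x / 2)) - (q (J x) - q x) * oddPart J (logCorr q b) x

omit [MeasurableSpace X] in
/-- K1 holds pointwise (with equality) for the optimal slack. -/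
theorem optSlack_pointwise (κ : ℝ) (x : X) :
    -(κ * (jeffreysIntegrand J q x / 2)) - optSlack J q b κ x = (q (J x) - q x) * oddPart J (logCorr q b) x := by
  unfold optSlack; ring

/-- The Jeffreys integrand is integrable under the kernel integrabilities `h1`, `h3`. -/
theorem integrable_jeffreysIntegrand (hJ : MeasurePreserving J μ μ) (hJJ : Involutive J)
    (h1 : Integrable (fun x => q x * Real.log (q x)) μ)
    (h3 : Integrable (fun x => q (J x) * Real.log (q x)) μ) :
    Integrable (fun x => jeffreysIntegrand J q x) μ := by
  have hJ2 : ∀ x, J (J x) = x := hJJ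
  have hemb : MeasurableEmbedding J :=
    (MeasurableEquiv.ofInvolutive J hJJ hJ.measurable).measurableEmbedding
  have i1 : Integrable (fun x => q (J x) * Real.log (q (J x))) μ :=
    (hJ.integrable_comp_emb hemb (g := fun x => q x * Real.log (q x))).2 h1
  have i6 : Integrable (fun x => q x * Real.log (q (J x))) μ := by
    have h := (hJ.integrable_comp_emb hemb (g := fun x => q (J x) * Real.log (q x))).2 h3
    refine h.congr (Filter.Eventually.of_forall fun x => ?_)
    simp [Function.comp, hJ2]
  have : (fun x => jeffreysIntegrand J q x)
      = fun x => (q (J x) * Real.log (q (J x)) - q (J x) * Real.log (q x))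
          - (q x * Real.log (q (J x)) - q x * Real.log (q x)) := by
    ext x; unfold jeffreysIntegrand; ring
  rw [this]; exact (i1.sub h3).sub (i6.sub h1)

/-- The odd-part integrand `(qJ − q)·ψ_odd` is integrable under the four kernel integrabilities. -/
theorem integrable_oddPartIntegrand (hJ : MeasurePreserving J μ μ) (hJJ : Involutive J)
    (h1 : Integrable (fun x => q x * Real.log (q x)) μ)
    (h2 : Integrable (fun x => q x * Real.log (b x)) μ)
    (h3 : Integrable (fun x => q (J x) * Real.log (q x)) μ)
    (h4 : Integrable (fun x => q (J x) * Real.log (b x)) μ) :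
    Integrable (fun x => (q (J x) - q x) * oddPart J (logCorr q b) x) μ := by
  have hJ2 : ∀ x, J (J x) = x := hJJ
  have hemb : MeasurableEmbedding J :=
    (MeasurableEquiv.ofInvolutive J hJJ hJ.measurable).measurableEmbedding
  set F : X → ℝ := fun x => (q (J x) - q x) * logCorr q b x with hF
  have iF : Integrable F μ := by
    have : F = fun x => (q (J x) * Real.log (q x) - q (J x) * Real.log (b x))
        - (q x * Real.log (q x) - q x * Real.log (b x)) := by
      ext x; simp only [hF, logCorr]; ring
    rw [this]; exact (h3.sub h4).sub (h1.sub h2)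
  have iFJ : Integrable (fun x => F (J x)) μ := (hJ.integrable_comp_emb hemb (g := F)).2 iF
  have hFJ : ∀ x, F (J x) = -((q (J x) - q x) * logCorr q b (J x)) := by
    intro x; simp only [hF, hJ2]; ring
  have key : (fun x => (q (J x) - q x) * oddPart J (logCorr q b) x)
      = fun x => (F x + F (J x)) / 2 := by
    ext x; rw [hFJ]; simp only [hF, oddPart]; ring
  rw [key]; exact (iF.add iFJ).div_const 2

/-- The optimal slack is integrable. -/
theorem integrable_optSlack (hJ : MeasurePreserving J μ μ) (hJJ : Involutive J)
    (h1 : Integrable (fun x => q x * Real.log (q x)) μ)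
    (h2 : Integrable (fun x => q x * Real.log (b x)) μ)
    (h3 : Integrable (fun x => q (J x) * Real.log (q x)) μ)
    (h4 : Integrable (fun x => q (J x) * Real.log (b x)) μ) (κ : ℝ) :
    Integrable (optSlack J q b κ) μ := by
  unfold optSlack
  exact (((integrable_jeffreysIntegrand hJ hJJ h1 h3).div_const 2).const_mul κ).neg.sub
    (integrable_oddPartIntegrand hJ hJJ h1 h2 h3 h4)

/-- **The integral of the optimal slack**: `∫ e⋆ = (1 − κ)·KL(QJ‖Q) − bookedProduction`. -/
theorem integral_optSlack (hJ : MeasurePreserving J μ μ) (hJJ : Involutive J)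
    (h1 : Integrable (fun x => q x * Real.log (q x)) μ)
    (h2 : Integrable (fun x => q x * Real.log (b x)) μ)
    (h3 : Integrable (fun x => q (J x) * Real.log (q x)) μ)
    (h4 : Integrable (fun x => q (J x) * Real.log (b x)) μ) (κ : ℝ) :
    ∫ x, optSlack J q b κ x ∂μ = (1 - κ) * asymmetryInfo μ J q - bookedProduction μ J q b := by
  have iJ := integrable_jeffreysIntegrand hJ hJJ h1 h3
  have iO := integrable_oddPartIntegrand hJ hJJ h1 h2 h3 h4
  have hJeff := integral_jeffreysIntegrand hJ hJJ h1 h3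
  have hX := oddLogCorrelation_eq_integral_oddPart hJ hJJ h1 h2 h3 h4
  have hId := bookedProduction_eq_asymmetryInfo_add_oddLogCorrelation hJ hJJ h1 h2 h3 h4
  have hneg : Integrable (fun x => -(κ * (jeffreysIntegrand J q x / 2))) μ := ((iJ.div_const 2).const_mul κ).neg
  have hs : ∫ x, optSlack J q b κ x ∂μ
      = (∫ x, -(κ * (jeffreysIntegrand J q x / 2)) ∂μ) - ∫ x, (q (J x) - q x) * oddPart J (logCorr q b) x ∂μ := by
    unfold optSlack
    exact integral_sub hneg iO
  have hn : ∫ x, -(κ * (jeffreysIntegrand J q x / 2)) ∂μ = -(∫ x, κ * (jeffreysIntegrand J q x / 2) ∂μ) :=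
    integral_neg _
  have hm : ∫ x, κ * (jeffreysIntegrand J q x / 2) ∂μ = κ * ∫ x, jeffreysIntegrand J q x / 2 ∂μ :=
    integral_const_mul _ _
  have hd : ∫ x, jeffreysIntegrand J q x / 2 ∂μ = (∫ x, jeffreysIntegrand J q x ∂μ) / 2 := integral_div _ _
  rw [hs, hn, hm, hd, hJeff, ← hX, hId]
  ring

/-- **COLLAPSE OF THE POINTWISE FORM.**  Under the four kernel integrabilities, "there is an integrable slack `e` with
`∫ e ≤ η` such that pointwise one-sided relative odd chaos at level `κ` holds a.e." is EQUIVALENT to the integrated budget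
`(1 − κ)·KL(QJ‖Q) ≤ bookedProduction + η`.  (So a sign-free existential slack carries no pointwise content.) -/
theorem exists_pointwise_iff_budget (hJ : MeasurePreserving J μ μ) (hJJ : Involutive J)
    (h1 : Integrable (fun x => q x * Real.log (q x)) μ)
    (h2 : Integrable (fun x => q x * Real.log (b x)) μ)
    (h3 : Integrable (fun x => q (J x) * Real.log (q x)) μ)
    (h4 : Integrable (fun x => q (J x) * Real.log (b x)) μ) (κ η : ℝ) :
    (∃ e : X → ℝ, Integrable e μ ∧ ∫ x, e x ∂μ ≤ η ∧
        ∀ᵐ x ∂μ, -(κ * (jeffreysIntegrand J q x / 2)) - e x ≤ (q (J x) - q x) * oddPart J (logCorr q b) x) ↔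
      (1 - κ) * asymmetryInfo μ J q ≤ bookedProduction μ J q b + η := by
  constructor
  · rintro ⟨e, he, heη, hK1⟩
    have h := asymmetryInfo_le_of_pointwise hJ hJJ h1 h2 h3 h4 he hK1
    linarith
  · intro hB
    refine ⟨optSlack J q b κ, integrable_optSlack hJ hJJ h1 h2 h3 h4 κ, ?_, ae_of_all _ fun x => ?_⟩
    · rw [integral_optSlack hJ hJJ h1 h2 h3 h4 κ]; linarith
    · rw [optSlack_pointwise]

end KernelCollapse

universe u in
/-- Registered anchor (`contactKernel_collapse`): the collapse of the pointwise form, as a closed statement. -/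
theorem contactKernel_collapse : ∀ {X : Type u} [MeasurableSpace X] {μ : Measure X} {J : X → X} {q b : X → ℝ}, MeasurePreserving J μ μ → Involutive J → Integrable (fun x => q x * Real.log (q x)) μ → Integrable (fun x => q x * Real.log (b x)) μ → Integrable (fun x => q (J x) * Real.log (q x)) μ → Integrable (fun x => q (J x) * Real.log (b x)) μ → ∀ (κ η : ℝ), (∃ e : X → ℝ, Integrable e μ ∧ ∫ x, e x ∂μ ≤ η ∧ ∀ᵐ x ∂μ, -(κ * (jeffreysIntegrand J q x / 2)) - e x ≤ (q (J x) - q x) * oddPart J (logCorr q b) x) ↔ (1 - κ) * asymmetryInfo μ J q ≤ bookedProduction μ J q b + η :=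
  fun hJ hJJ h1 h2 h3 h4 κ η => exists_pointwise_iff_budget hJ hJJ h1 h2 h3 h4 κ η

end Summit.AtomisticToContinuum.HydrodynamicLimit.Theorems.LocalSecondLawContact

end
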